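import Summits.CriticalPhenomena.Ising3DConformalLimit.Theorems.EnergyNotSigmaSquaredGapForcesFarMergingScaleIteration
import Summits.CriticalPhenomena.Ising3DConformalLimit.Theorems.EnergyNotSigmaSquaredGapForcesFarMergingUnpinchedEnvelope
import Summits.CriticalPhenomena.Ising3DConformalLimit.Theorems.GapForcesFarMerging.Negative.LineVerdicts

/-!
# `GapForcesFarMerging`: the scale iteration consumes only DYADIC quasi-multiplicativity with
# sub-exponential defect; the crux reduces to three stubs (crux stmt-CriticalPhenomena-4468, standing adversary gen 3)

Part 4/4 of the audit of the line `rp-unpinch-single-passage` (Parts 1–3: `Negative/LineShapes`,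
`LineFamily`, `LineVerdicts`; the soft scale iteration itself was landed by the lead as
`EnergyNotSigmaSquaredGapForcesFarMergingScaleIteration` from the adversary's work file §7, and stub 2
as `…UnpinchedEnvelope`). Here:

* `QuasiMultiplicativeDyadicShape` — what the iteration REALLY consumes: for every rate `η ∈ (0,1)`
  and all large passage lengths `ℓ`, a constant `c(ℓ) ≥ η^ℓ` (defect `2^{-o(ℓ)}`) with
  `c(ℓ)·𝒜(e₂;2^i)·𝒜(2^i e₂;2^{i+ℓ}) ≤ 𝒜(e₂;2^{i+ℓ})` for all large `i`; implied by the registered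
  uniform stub 4 (`qmDyadic_of_qm`), strictly weaker in form (pairs `(2^i,2^{i+ℓ})` only, constant
  allowed to decay sub-exponentially in `ℓ`, finitely many exceptional `i`).
* **`scaleIteration_soft_dyadic`**: over any triple with the soft package,
  `SinglePinchLawShape → SinglePinchPositiveShape → QuasiMultiplicativeDyadicShape → FarMergingShape`
  (same iteration as the lead's `scaleIteration_soft`, with `η = √r`, `r = 2^{-κ'}`).
* **`gapForcesFarMerging_of_three_stubs`**: the crux `GapForcesFarMerging` follows from the
  ISOSCELES RP minors (`RPUnpinchIsoShape`), strict single-pinch positivity and dyadic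
  quasi-multiplicativity alone — the envelope is the lead's theorem `stub_unpinchedEnvelope`
  (`unpinchedEnvelopeShape_criticalCorr`), GAP is consumed once as in `gapGivesSinglePinch`, and
  stub 5 is soft. With Part 3: family A′ violates even the dyadic form
  (`not_quasiMultiplicativeDyadicShape_A'`, `quasiMultiplicativeDyadic_false_without_model`) — the
  (dyadic) quasi-multiplicativity is exactly where the model enters the line.

## References

* M. Aizenman, Comm. Math. Phys. 86 (1982) 1–48, §§4–5 [AizenmanCMP1982].
* M. Aizenman, H. Duminil-Copin, Ann. Math. 194 (2021), §5.1 eq. (5.3) [AizenmanDuminilCopinAnnals2021].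
* J. Fröhlich, R. Israel, E. H. Lieb, B. Simon, Comm. Math. Phys. 62 (1978) 1–34, Thm. 2.1 [FILS1978].
* G. F. Lawler, Intersections of Random Walks (1991), ch. 3–5 [Lawler1991].
-/

noncomputable section

namespace Summit.CriticalPhenomena.Ising3DConformalLimit.Theorems.GapForcesFarMerging.Negative

open Literature.Probability.LatticeModels
open Summit.CriticalPhenomena.Ising3DConformalLimit.Theses.EnergyNotSigmaSquared
open Summit.CriticalPhenomena.Ising3DConformalLimit.EnergyNotSigmaSquaredGapForcesFarMerging (stub_unpinchedEnvelope)
open Summit.CriticalPhenomena.Ising3DConformalLimit.EnergyNotSigmaSquaredGapForcesFarMerging.ScaleIteration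
  (NparS_pos half_lt_avoidS_of_not_merge avoidS_dyadic_le exists_good_scale)

section softIteration

variable {S : Site 3 → Site 3 → ℝ} {T : Site 3 → ℝ} {F : (Fin 4 → Site 3) → ℝ}

/-- **Dyadic quasi-multiplicativity with sub-exponential defect** — what the iteration really
consumes: for every rate `η ∈ (0,1)` and all large passage lengths `ℓ`, a constant `c(ℓ) ≥ η^ℓ`
(i.e. `c(ℓ) ≥ 2^{-o(ℓ)}`) with `c(ℓ)·𝒜(e₂;2^i)·𝒜(2^i e₂;2^{i+ℓ}) ≤ 𝒜(e₂;2^{i+ℓ})` for all large `i`.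
Implied by `QuasiMultiplicativeShape` (`qmDyadic_of_qm`); a lead whose engine loses `2^{o(ℓ)}` per
passage of `ℓ` octaves proves this instead of stub 4 and still gets the crux. [folklore] -/
def QuasiMultiplicativeDyadicShape (S : Site 3 → Site 3 → ℝ) (F : (Fin 4 → Site 3) → ℝ) : Prop :=
  ∀ η : ℝ, 0 < η → η < 1 → ∃ ℓ₀ : ℕ, ∀ ℓ : ℕ, ℓ₀ ≤ ℓ → ∃ c : ℝ, η ^ ℓ ≤ c ∧ ∃ i₁ : ℕ, ∀ i : ℕ, i₁ ≤ i →
    c * avoidS S F e₂ (2 ^ i) * avoidS S F (src (2 ^ i)) (2 ^ (i + ℓ)) ≤ avoidS S F e₂ (2 ^ (i + ℓ))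

/-- Uniform one-passage quasi-multiplicativity implies the dyadic sub-exponential-defect form. [folklore] -/
theorem qmDyadic_of_qm (h : QuasiMultiplicativeShape S F) : QuasiMultiplicativeDyadicShape S F := by
  obtain ⟨c, hc, hqm⟩ := h
  intro η hη0 hη1
  obtain ⟨ℓ₀, hℓ₀⟩ := exists_pow_lt_of_lt_one hc hη1
  refine ⟨max ℓ₀ 1, fun ℓ hℓ => ⟨c, ?_, 0, fun i _ => hqm (2 ^ i) (2 ^ (i + ℓ)) Nat.one_le_two_pow ?_⟩⟩
  · exact ((pow_le_pow_of_le_one hη0.le hη1.le ((le_max_left _ _).trans hℓ)).trans hℓ₀.le)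
  · have h2 : 2 ≤ 2 ^ ℓ :=
      calc 2 = 2 ^ 1 := (pow_one 2).symm
        _ ≤ 2 ^ ℓ := Nat.pow_le_pow_right (by norm_num) ((le_max_right _ _).trans hℓ)
    rw [pow_add, mul_comm]; exact Nat.mul_le_mul_left _ h2

/-- **Stub 5 is soft, in the sharper dyadic form.** Over any triple with the soft package:
single-pinch law + strict single-pinch positivity + DYADIC quasi-multiplicativity with sub-exponential
defect ⟹ far merging (along a thin shape `Th(2^ℓ)`, by contradiction with `c = 1/2`). [folklore] -/
theorem scaleIteration_soft_dyadic (hP : SoftPackageNoBubble S T F) :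
    SinglePinchLawShape S T F → SinglePinchPositiveShape S F → QuasiMultiplicativeDyadicShape S F →
      FarMergingShape S F := by
  rintro ⟨κ', C, hκ', hspl⟩ hSPP hQMD
  by_contra hFM
  -- the avoidance sequence along dyadic scales and its positivity
  set A : ℕ → ℝ := fun i => avoidS S F e₂ (2 ^ i) with hA
  have hApos : ∀ i, 0 < A i := fun i =>
    div_pos (hSPP (2 ^ i) Nat.one_le_two_pow) (NparS_pos hP _ _)
  -- r = 2^{-κ'} ∈ (0,1), η = √r; choose ℓ ≥ 1 with η^ℓ ≤ 1/4 and a constant c ≥ η^ℓ along (2^i, 2^{i+ℓ})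
  set r : ℝ := (2 : ℝ) ^ (-κ') with hr
  have hr0 : 0 < r := Real.rpow_pos_of_pos two_pos _
  have hr1 : r < 1 := Real.rpow_lt_one_of_one_lt_of_neg one_lt_two (by linarith)
  set η : ℝ := Real.sqrt r with hη
  have hη0 : 0 < η := Real.sqrt_pos.2 hr0
  have hη1 : η < 1 := by rw [hη, ← Real.sqrt_one]; exact Real.sqrt_lt_sqrt hr0.le hr1
  have hηr : η ^ 2 = r := Real.sq_sqrt hr0.le
  obtain ⟨ℓ₀, hℓ₀⟩ := hQMD η hη0 hη1
  obtain ⟨ℓ₁, hℓ₁⟩ := exists_pow_lt_of_lt_one (show (0 : ℝ) < 1 / 4 by norm_num) hη1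
  obtain ⟨ℓ, hℓ1, hℓℓ₀, hℓℓ₁⟩ : ∃ ℓ : ℕ, 1 ≤ ℓ ∧ ℓ₀ ≤ ℓ ∧ ℓ₁ ≤ ℓ :=
    ⟨max (max ℓ₀ ℓ₁) 1, le_max_right _ _, (le_max_left _ _).trans (le_max_left _ _),
      (le_max_right _ _).trans (le_max_left _ _)⟩
  obtain ⟨c, hcη, i₁, hqm⟩ := hℓ₀ ℓ hℓℓ₀
  have hηℓ : 0 < η ^ ℓ := pow_pos hη0 ℓ
  have hc : 0 < c := lt_of_lt_of_le hηℓ hcη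
  have hrℓ : r ^ ℓ ≤ c / 4 := by
    have h1 : η ^ ℓ ≤ 1 / 4 := (pow_le_pow_of_le_one hη0.le hη1.le hℓℓ₁).trans hℓ₁.le
    calc r ^ ℓ = η ^ ℓ * η ^ ℓ := by rw [← hηr, ← pow_mul, mul_comm 2 ℓ, pow_mul, sq]
      _ ≤ (1 / 4) * c := mul_le_mul h1 hcη hηℓ.le (by norm_num)
      _ = c / 4 := by ring
  have h2ℓ : 2 ≤ 2 ^ ℓ :=
    calc 2 = 2 ^ 1 := (pow_one 2).symm
      _ ≤ 2 ^ ℓ := Nat.pow_le_pow_right (by norm_num) hℓ1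
  -- no far merging along the thin shape Th(2^ℓ) with c = 1/2
  have hFM' := hFM
  unfold FarMergingShape at hFM'
  push Not at hFM'
  obtain ⟨L₀, hL₀⟩ := hFM' (1 / 2) (by norm_num) (Th (2 ^ ℓ)) (Th_injective Nat.one_le_two_pow)
  set I₀ : ℕ := max L₀ i₁ with hI₀
  -- one step of the iteration
  have step : ∀ i, I₀ ≤ i → c / 2 * A i ≤ A (i + ℓ) := by
    intro i hi
    have hiL : L₀ ≤ i := (le_max_left _ _).trans hi
    have hi₁ : i₁ ≤ i := (le_max_right _ _).trans hi
    have hL := hL₀ (2 ^ i) (hiL.trans Nat.lt_two_pow_self.le)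
    obtain ⟨h0, h1, h2, h3⟩ := smul_Th_pts (2 ^ ℓ) (2 ^ i)
    rw [smul_Th, h0, h1, h2, h3] at hL
    have hav := half_lt_avoidS_of_not_merge hP hL
    rw [show 2 ^ ℓ * 2 ^ i = 2 ^ (i + ℓ) by rw [← pow_add, add_comm]] at hav
    have hq := hqm i hi₁
    have hAi : 0 ≤ A i := (hApos i).le
    show c / 2 * A i ≤ A (i + ℓ)
    have : c / 2 * A i ≤ c * avoidS S F e₂ (2 ^ i) * avoidS S F (src (2 ^ i)) (2 ^ (i + ℓ)) := by
      have := mul_nonneg hc.le hAi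
      show c / 2 * A i ≤ c * A i * avoidS S F (src (2 ^ i)) (2 ^ (i + ℓ))
      nlinarith
    exact this.trans hq
  -- the iteration
  have iter : ∀ i, I₀ ≤ i → ∀ k : ℕ, (c / 2) ^ k * A i ≤ A (i + k * ℓ) := by
    intro i hi k
    induction k with
    | zero => simp
    | succ k ih =>
      have hs := step (i + k * ℓ) (by omega)
      rw [show i + (k + 1) * ℓ = i + k * ℓ + ℓ by ring]
      calc (c / 2) ^ (k + 1) * A i = (c / 2) * ((c / 2) ^ k * A i) := by ring
        _ ≤ (c / 2) * A (i + k * ℓ) := mul_le_mul_of_nonneg_left ih (by positivity)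
        _ ≤ A (i + k * ℓ + ℓ) := hs
  -- a uniform positive floor over the ℓ starting scales
  obtain ⟨j₀, hj₀, hmin⟩ := Finset.exists_min_image (Finset.range ℓ) (fun j => A (I₀ + j))
    ⟨0, Finset.mem_range.2 (by omega)⟩
  set a₀ := A (I₀ + j₀) with ha₀
  have ha₀pos : 0 < a₀ := hApos _
  have lower : ∀ i, I₀ ≤ i → (c / 2) ^ ((i - I₀) / ℓ) * a₀ ≤ A i := by
    intro i hi
    have hdecomp : i = I₀ + (i - I₀) % ℓ + (i - I₀) / ℓ * ℓ := by
      have := Nat.mod_add_div (i - I₀) ℓ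
      rw [mul_comm] ; omega
    have hjlt : (i - I₀) % ℓ < ℓ := Nat.mod_lt _ (by omega)
    have h1 := iter (I₀ + (i - I₀) % ℓ) (by omega) ((i - I₀) / ℓ)
    rw [← hdecomp] at h1
    have h2 : a₀ ≤ A (I₀ + (i - I₀) % ℓ) := hmin _ (Finset.mem_range.2 hjlt)
    calc (c / 2) ^ ((i - I₀) / ℓ) * a₀ ≤ (c / 2) ^ ((i - I₀) / ℓ) * A (I₀ + (i - I₀) % ℓ) :=
          mul_le_mul_of_nonneg_left h2 (by positivity)
      _ ≤ A i := h1
  -- choose the depth k₀ and a good scale beyond it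
  set Cp : ℝ := max C 0 with hCp
  have hCp0 : 0 ≤ Cp := le_max_right _ _
  obtain ⟨k₀, hk₀⟩ := exists_pow_lt_of_lt_one (show 0 < a₀ / (1024 * Cp + 1) by positivity)
    (show (1 / 2 : ℝ) < 1 by norm_num)
  obtain ⟨i, hiN, hgood⟩ := exists_good_scale hP (I₀ + k₀ * ℓ)
  have hiL : I₀ ≤ i := by omega
  set k : ℕ := (i - I₀) / ℓ with hk
  have hk₀k : k₀ ≤ k := (Nat.le_div_iff_mul_le (by omega)).2 (by omega)
  have hkℓ : k * ℓ ≤ i + 1 := (Nat.div_mul_le_self (i - I₀) ℓ).trans (by omega)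
  -- upper bound at the good scale
  have hup : A i ≤ 1024 * Cp * r ^ (i + 1) := by
    have h := avoidS_dyadic_le hP hspl i
    have hb3 : 0 < S 0 (Pi.single 0 ((2 ^ (i + 3) : ℕ) : ℤ)) := hP.pos _ _
    have hb1 : 0 ≤ S 0 (Pi.single 0 ((2 ^ (i + 1) : ℕ) : ℤ)) := (hP.pos _ _).le
    have hratio : S 0 (Pi.single 0 ((2 ^ (i + 1) : ℕ) : ℤ)) ^ 2 /
        S 0 (Pi.single 0 ((2 ^ (i + 3) : ℕ) : ℤ)) ^ 2 ≤ 1024 := by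
      rw [div_le_iff₀ (by positivity)]
      nlinarith [mul_le_mul hgood hgood hb1 (by positivity)]
    calc A i ≤ Cp * r ^ (i + 1) * S 0 (Pi.single 0 ((2 ^ (i + 1) : ℕ) : ℤ)) ^ 2 /
          S 0 (Pi.single 0 ((2 ^ (i + 3) : ℕ) : ℤ)) ^ 2 := h
      _ = Cp * r ^ (i + 1) * (S 0 (Pi.single 0 ((2 ^ (i + 1) : ℕ) : ℤ)) ^ 2 /
          S 0 (Pi.single 0 ((2 ^ (i + 3) : ℕ) : ℤ)) ^ 2) := by ring
      _ ≤ Cp * r ^ (i + 1) * 1024 := mul_le_mul_of_nonneg_left hratio (by positivity)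
      _ = 1024 * Cp * r ^ (i + 1) := by ring
  -- r^{i+1} ≤ (r^ℓ)^k ≤ (c/4)^k = (c/2)^k (1/2)^k
  have hrk : r ^ (i + 1) ≤ (c / 2) ^ k * (1 / 2) ^ k := by
    calc r ^ (i + 1) ≤ r ^ (k * ℓ) := pow_le_pow_of_le_one hr0.le hr1.le hkℓ
      _ = (r ^ ℓ) ^ k := by rw [mul_comm, pow_mul]
      _ ≤ (c / 4) ^ k := pow_le_pow_left₀ (by positivity) hrℓ k
      _ = (c / 2) ^ k * (1 / 2) ^ k := by rw [← mul_pow]; ring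
  -- combine
  have hck : 0 < (c / 2) ^ k := by positivity
  have hmain : (c / 2) ^ k * a₀ ≤ (c / 2) ^ k * (1024 * Cp * (1 / 2) ^ k) := by
    calc (c / 2) ^ k * a₀ ≤ A i := lower i hiL
      _ ≤ 1024 * Cp * r ^ (i + 1) := hup
      _ ≤ 1024 * Cp * ((c / 2) ^ k * (1 / 2) ^ k) := mul_le_mul_of_nonneg_left hrk (by positivity)
      _ = (c / 2) ^ k * (1024 * Cp * (1 / 2) ^ k) := by ring
  have h1 : a₀ ≤ 1024 * Cp * (1 / 2) ^ k := le_of_mul_le_mul_left hmain hck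
  have h2 : (1 / 2 : ℝ) ^ k ≤ (1 / 2) ^ k₀ := pow_le_pow_of_le_one (by norm_num) (by norm_num) hk₀k
  have h3 : (1 / 2 : ℝ) ^ k₀ * (1024 * Cp + 1) < a₀ := by
    rwa [lt_div_iff₀ (by positivity)] at hk₀
  nlinarith [mul_le_mul_of_nonneg_left h2 (by positivity : (0 : ℝ) ≤ 1024 * Cp),
    pow_pos (show (0 : ℝ) < 1 / 2 by norm_num) k₀]

end softIteration

/-! ## The Ising instances and the reduction of the crux to three stubs -/

section ising

/-- The dyadic scale iteration at the critical correlators of `ℤ³` (Ising certificate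
`softPackageNoBubble_criticalCorr`). [folklore] -/
theorem scaleIteration_dyadic_criticalCorr :
    SinglePinchLawShape cc2 (criticalTwoPoint 3) (criticalCorr 3 4) →
      SinglePinchPositiveShape cc2 (criticalCorr 3 4) →
        QuasiMultiplicativeDyadicShape cc2 (criticalCorr 3 4) → FarMergingShape cc2 (criticalCorr 3 4) :=
  scaleIteration_soft_dyadic softPackageNoBubble_criticalCorr

/-- Stub 2 in shape form: the lead's `stub_unpinchedEnvelope` IS `UnpinchedEnvelopeShape` at the
critical correlators (definitional unfolding of `up`, `dn`, `xR`, `pairCovS`). [cite: Lebowitz1974, Theorem, eq. (2.5b)] -/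
theorem unpinchedEnvelopeShape_criticalCorr :
    UnpinchedEnvelopeShape cc2 (criticalTwoPoint 3) (criticalCorr 3 4) :=
  stub_unpinchedEnvelope

/-- **GAP un-pinched with the landed envelope**: the isosceles RP minors and `EnergyGapPowerLaw`
give the single-pinch law with exponent `κ/2` (the skeleton's `gapGivesSinglePinch`, envelope
discharged). [cite: FILS1978, Thm. 2.1] -/
theorem singlePinchLaw_of_gap_and_isoRP (h1 : RPUnpinchIsoShape cc2 (criticalCorr 3 4))
    (hGAP : EnergyGapPowerLaw) : SinglePinchLawShape cc2 (criticalTwoPoint 3) (criticalCorr 3 4) := by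
  obtain ⟨κ, C, hκ, hG⟩ := hGAP
  refine ⟨κ / 2, Real.sqrt (2 * max C 0), by positivity, fun m hm => ?_⟩
  have hgap : pairCovS cc2 (criticalCorr 3 4) 0 e₂ (xR m) (xR m + e₂) ≤
      max C 0 * (2 * (m : ℝ)) ^ (-κ) * criticalTwoPoint 3 (xR m) ^ 2 := by
    have hx : xR m ≠ 0 := by
      intro h; have := congrFun h 0; simp [xR] at this; omega
    have h := hG (xR m) hx
    have hn : ‖xR m‖ = 2 * (m : ℝ) := by
      rw [xR, Pi.norm_single, Int.norm_eq_abs]; push_cast; rw [abs_of_nonneg (by positivity)]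
    rw [hn] at h
    refine (le_of_eq_of_le rfl h).trans ?_
    gcongr
    exact le_max_left _ _
  obtain ⟨hE0, hE2⟩ := unpinchedEnvelopeShape_criticalCorr m hm
  have hRP := h1 m hm
  set t := pairCovS cc2 (criticalCorr 3 4) 0 e₂ (up m) (dn m)
  set g := criticalTwoPoint 3 (xR m)
  set B := Real.sqrt (2 * max C 0) * (2 * (m : ℝ)) ^ (-(κ / 2)) * g ^ 2 with hB
  have hm0 : (0 : ℝ) < 2 * (m : ℝ) := by
    have : (1 : ℝ) ≤ m := by exact_mod_cast hm
    linarith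
  have hB0 : 0 ≤ B := by positivity
  have key : t ^ 2 ≤ (max C 0 * (2 * (m : ℝ)) ^ (-κ) * g ^ 2) * (2 * g ^ 2) :=
    hRP.trans (mul_le_mul hgap hE2 hE0 (by positivity))
  have hsq : (max C 0 * (2 * (m : ℝ)) ^ (-κ) * g ^ 2) * (2 * g ^ 2) = B ^ 2 := by
    have h2' : ((2 * (m : ℝ)) ^ (-(κ / 2))) ^ 2 = (2 * (m : ℝ)) ^ (-κ) := by
      rw [← Real.rpow_natCast ((2 * (m : ℝ)) ^ (-(κ / 2))) 2, ← Real.rpow_mul hm0.le]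
      norm_num
    rw [hB, mul_pow, mul_pow, Real.sq_sqrt (by positivity), h2']
    ring
  calc t ≤ |t| := le_abs_self t
    _ = Real.sqrt (t ^ 2) := (Real.sqrt_sq_eq_abs t).symm
    _ ≤ Real.sqrt (B ^ 2) := Real.sqrt_le_sqrt (key.trans_eq hsq)
    _ = B := Real.sqrt_sq hB0

/-- **The crux from three stubs.** `GapForcesFarMerging` follows from the isosceles RP minors
(stub 1 restricted to the instances the glue uses), strict single-pinch positivity (stub 3) and
DYADIC quasi-multiplicativity with sub-exponential defect (a weakening of stub 4): stub 2 is the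
lead's theorem and stub 5 is soft. [folklore] -/
theorem gapForcesFarMerging_of_three_stubs (h1 : RPUnpinchIsoShape cc2 (criticalCorr 3 4))
    (h3 : SinglePinchPositiveShape cc2 (criticalCorr 3 4))
    (h4 : QuasiMultiplicativeDyadicShape cc2 (criticalCorr 3 4)) : GapForcesFarMerging := by
  rw [crux_iff_shapes]
  intro hGAP
  exact scaleIteration_dyadic_criticalCorr (singlePinchLaw_of_gap_and_isoRP h1 hGAP) h3 h4

/-- The same with the registered (uniform) stub 4. [folklore] -/
theorem gapForcesFarMerging_of_three_stubs' (h1 : RPUnpinchIsoShape cc2 (criticalCorr 3 4))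
    (h3 : SinglePinchPositiveShape cc2 (criticalCorr 3 4))
    (h4 : QuasiMultiplicativeShape cc2 (criticalCorr 3 4)) : GapForcesFarMerging :=
  gapForcesFarMerging_of_three_stubs h1 h3 (qmDyadic_of_qm h4)

end ising


/-! ## Even the dyadic form is not soft: family A′ again -/

section dyadicNoGo

/-- A′ has the package without the bubble field. [folklore] -/
theorem softPackageNoBubble_A' : SoftPackageNoBubble S₀ T₀ FA' :=
  ((softPackage_iff_noBubble_and_bubble _ _ _).1 softPackage_A').1

/-- **A′ violates even the dyadic, sub-exponential-defect quasi-multiplicativity** — by the dyadic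
iteration itself, since A′ has the single-pinch law, strict positivity and no far merging. [folklore] -/
theorem not_quasiMultiplicativeDyadicShape_A' : ¬ QuasiMultiplicativeDyadicShape S₀ FA' := fun h =>
  not_farMergingShape_A'
    (scaleIteration_soft_dyadic softPackageNoBubble_A' singlePinchLawShape_A' singlePinchPositiveShape_A' h)

/-- **The weakened stub 4 is not soft either**: no argument from the soft package + GAP + isosceles
RP minors + envelope + single-pinch law + strict positivity proves dyadic quasi-multiplicativity. [folklore] -/
theorem quasiMultiplicativeDyadic_false_without_model :
    ¬ ∀ (S : Site 3 → Site 3 → ℝ) (T : Site 3 → ℝ) (F : (Fin 4 → Site 3) → ℝ),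
      SoftPackage S T F → GapShape S T F → RPUnpinchIsoShape S F → UnpinchedEnvelopeShape S T F →
        SinglePinchLawShape S T F → SinglePinchPositiveShape S F → QuasiMultiplicativeDyadicShape S F :=
  fun h => not_quasiMultiplicativeDyadicShape_A' (h S₀ T₀ FA' softPackage_A' gapShape_A'
    rpUnpinchIsoShape_A' unpinchedEnvelopeShape_A' singlePinchLawShape_A' singlePinchPositiveShape_A')

end dyadicNoGo

end Summit.CriticalPhenomena.Ising3DConformalLimit.Theorems.GapForcesFarMerging.Negative

end
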